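import Summits.AnomalousDissipation.AnomalousDissipation.Theorems.MarginalStabilityChainStrainedLayerLawClockEnstrophyMeanFloorConverse
import Summits.AnomalousDissipation.AnomalousDissipation.Theorems.MarginalStabilityChainStrainedLayerLawClockLaminar
import HarnessLib

/-!
# Crux `MarginalStabilityChain.StrainedLayerLaw` (stmt-AnomalousDissipation-3007), line `FirstLemmasR2K4`:
# energy relaminarisation forces the LAMINAR mean dissipation

Support file (`--supports stmt-AnomalousDissipation-3007`; registered sub-goal
`meanLayerDissipation_laminar_of_energyDecay` of line `FirstLemmasR2K4`, lead c7).

What it proves: for ONE classical solution `(u, v, p)` of the stretched layer class on `(0, ∞)` (`ν > 0`, period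
`L > 0`) with shear tails on every compact time window and locally finite dissipation, IF the perturbation energy
`W(τ) = ∫∫ ((u − U_B)² + v²)` about the laminar Burgers layer `U_B = burgersLayerProfile 1 ν 1` relaxes,
`W(t) ≤ e^{−(t−s)/2} W(s)`, with the gradient budget `ν ∫_s^t ‖∇w‖² ≤ (3/2 + 1/(πν)) W(s)`
(`‖∇w‖² = ∫∫ (uₓ² + (u_y − U_B')² + vₓ² + v_y²)`, `U_B' = burgersLayerProfileD 1 ν 1`; both are the conclusions of
the neighbouring sub-goal `energy_relaminarisation`, here HYPOTHESES), THEN the long-time mean dissipation is EXACTLY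
the laminar Sweet–Parker value: `meanLayerDissipation ν L u v = ofReal (√ν/(2√π))`.

Proof. On a window `[1, T]` the dissipation is the real number `L·D(τ) = ν ∫∫ |∇(u,v)|²` (`faces_enstrophy`,
`faces_slice`, `kato_integral_gradSq_eq_enstrophy`). Pointwise
`|uₓ² + u_y² + vₓ² + v_y² − U_B'²| ≤ δ U_B'² + (1 + 1/δ)(uₓ² + (u_y − U_B')² + vₓ² + v_y²)` for every `δ > 0`, and
`ν L ∫ U_B'² = L √ν/(2√π)` (`nu_mul_integral_burgersLayerProfileD_sq`), so
`|L ∫_1^T D − (T − 1) L √ν/(2√π)| ≤ δ (T − 1) L √ν/(2√π) + (1 + 1/δ) ν ∫_1^T ‖∇w‖²`, and the last integral is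
bounded by the budget. Dividing by `T` and letting `T → ∞`, then `δ → 0`, the Cesàro means converge (as real
numbers, then in `ℝ≥0∞` via `ENNReal.tendsto_ofReal`; the head `(0, 1]` is a finite constant), and the `liminf`
of a convergent function is its limit. Only time-continuity of `τ ↦ ‖∇w(τ)‖²` (dominated convergence on the strip)
is needed to make the time integrals honest. No facts are asserted; no definitions.
-/

-- `Summit.<Summit>.<Problem>` is the tree's mandated summit-side namespace (CONVENTIONS §2); for this
-- single-conjunct summit the two coincide, so the duplicate is deliberate.
set_option linter.dupNamespace false

noncomputable section

open scoped Topology ENNReal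
open Filter Set Function MeasureTheory

namespace Summit.AnomalousDissipation.AnomalousDissipation.Theorems.StrainedLayerLaw.LogEnstrophyClock

open Literature.Analysis.FluidPDE Literature.Analysis.FluidPDE.StretchedLayer
open Summit.AnomalousDissipation.AnomalousDissipation.Theses.MarginalStabilityChain
open Summit.AnomalousDissipation.AnomalousDissipation.Theorems.StrainedLayerLaw.StrainWorkSumRule

section LaminarMean

variable {ν L : ℝ} {u v p : ℝ → ℝ → ℝ → ℝ}

/-- The pointwise algebra behind the laminar mean: for every `δ > 0`,
`|uₓ² + u_y² + vₓ² + v_y² − b²| ≤ δ b² + (1 + 1/δ)(uₓ² + (u_y − b)² + vₓ² + v_y²)`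
(`u_y² − b² = (u_y − b)² + 2b(u_y − b)` and `2|b(u_y − b)| ≤ δb² + (u_y − b)²/δ`). [folklore] -/
theorem laminarMean_pointwise (ux uy vx vy b : ℝ) {δ : ℝ} (hδ : 0 < δ) :
    |ux ^ 2 + uy ^ 2 + vx ^ 2 + vy ^ 2 - b ^ 2| ≤
      δ * b ^ 2 + (1 + 1 / δ) * (ux ^ 2 + (uy - b) ^ 2 + vx ^ 2 + vy ^ 2) := by
  set e : ℝ := uy - b with he
  have huy : uy = b + e := by rw [he]; ring
  have hr : 0 ≤ ux ^ 2 + vx ^ 2 + vy ^ 2 := by positivity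
  have hw : 0 ≤ ux ^ 2 + e ^ 2 + vx ^ 2 + vy ^ 2 := by positivity
  -- `2 b e ≤ δ b² + e²/δ` and `−2 b e ≤ δ b² + e²/δ`
  have hte : e = δ * (e / δ) := by field_simp
  have k1 : 2 * b * e ≤ δ * b ^ 2 + e ^ 2 / δ := by
    have h0 : 0 ≤ δ * (b - e / δ) ^ 2 := by positivity
    have h1 : δ * (b - e / δ) ^ 2 = δ * b ^ 2 + e ^ 2 / δ - 2 * b * e := by
      field_simp
      ring
    linarith
  have k2 : -(2 * b * e) ≤ δ * b ^ 2 + e ^ 2 / δ := by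
    have h0 : 0 ≤ δ * (b + e / δ) ^ 2 := by positivity
    have h1 : δ * (b + e / δ) ^ 2 = δ * b ^ 2 + e ^ 2 / δ + 2 * b * e := by
      field_simp
      ring
    linarith
  have hdiv : e ^ 2 / δ ≤ (ux ^ 2 + e ^ 2 + vx ^ 2 + vy ^ 2) / δ :=
    div_le_div_of_nonneg_right (by linarith) hδ.le
  have hexp : (1 + 1 / δ) * (ux ^ 2 + e ^ 2 + vx ^ 2 + vy ^ 2) =
      (ux ^ 2 + e ^ 2 + vx ^ 2 + vy ^ 2) + (ux ^ 2 + e ^ 2 + vx ^ 2 + vy ^ 2) / δ := by ring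
  have hid : ux ^ 2 + uy ^ 2 + vx ^ 2 + vy ^ 2 - b ^ 2 = (ux ^ 2 + e ^ 2 + vx ^ 2 + vy ^ 2) + 2 * b * e := by
    rw [huy]; ring
  rw [hid, hexp, abs_le]
  constructor <;> linarith

/-- Smaller decay rates are weaker: `SliceTails C k ⇒ SliceTails C k'` for `k' ≤ k`. [folklore] -/
theorem laminarMean_sliceTails_mono {C k k' : ℝ} {f g : ℝ → ℝ → ℝ} (h : SliceTails C k f g) (hk' : k' ≤ k) :
    SliceTails C k' f g := by
  intro x y
  have hC := h.nonneg
  have hmono : C * Real.exp (-k * |y|) ≤ C * Real.exp (-k' * |y|) :=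
    mul_le_mul_of_nonneg_left (Real.exp_le_exp.2 (by nlinarith [abs_nonneg y])) hC
  obtain ⟨h1, h2, h3, h4⟩ := h x y
  exact ⟨h1.trans hmono, h2.trans hmono, h3.trans hmono, h4.trans hmono⟩

/-- **The window estimate.** Along a tailed solution, for `T > 1` and every `δ > 0`:
`|L ∫_{(1,T]} D − (T − 1) L √ν/(2√π)| ≤ δ (T − 1) L √ν/(2√π) + (1 + 1/δ) ν ∫_1^T ‖∇w‖²`
(`faces_enstrophy` for the window as a real time integral, `laminarMean_pointwise` integrated over the strip and
then in time; the time integral of `‖∇w‖²` is honest by dominated convergence on the strip). [folklore] -/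
theorem laminarMean_window (hν : 0 < ν) (hL : 0 < L) (hsol : IsStretchedLayerNSSolutionOn (Ioi 0) ν 1 1 L u v p)
    (htails : ∀ a b : ℝ, 0 < a → a < b → ExpTails (Icc a b) u v) {T δ : ℝ} (hT : 1 < T) (hδ : 0 < δ) :
    |L * (∫⁻ t in Ioc 1 T, layerDissipation ν L (u t) (v t)).toReal -
        Real.sqrt ν / (2 * Real.sqrt Real.pi) * L * (T - 1)| ≤
      δ * (Real.sqrt ν / (2 * Real.sqrt Real.pi) * L) * (T - 1) +
        (1 + 1 / δ) * (ν * ∫ τ in (1:ℝ)..T, ∫ x in Ioc 0 L, ∫ y,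
          (dX (u τ) x y ^ 2 + (dY (u τ) x y - burgersLayerProfileD 1 ν 1 y) ^ 2 +
            dX (v τ) x y ^ 2 + dY (v τ) x y ^ 2)) := by
  -- names
  set U' : ℝ → ℝ := burgersLayerProfileD 1 ν 1 with hU'
  set c : ℝ := Real.sqrt ν / (2 * Real.sqrt Real.pi) with hc
  set Ω : ℝ → ℝ := fun τ => ∫ x in Ioc 0 L, ∫ y, vorticity (u τ) (v τ) x y ^ 2 with hΩ
  set X : ℝ → ℝ := fun σ => ∫ q in Ioc 0 L ×ˢ univ, (dX (u σ) q.1 q.2 ^ 2 + dY (u σ) q.1 q.2 ^ 2 +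
    dX (v σ) q.1 q.2 ^ 2 + dY (v σ) q.1 q.2 ^ 2) with hX
  set W : ℝ → ℝ := fun σ => ∫ q in Ioc 0 L ×ˢ univ, (dX (u σ) q.1 q.2 ^ 2 + (dY (u σ) q.1 q.2 - U' q.2) ^ 2 +
    dX (v σ) q.1 q.2 ^ 2 + dY (v σ) q.1 q.2 ^ 2) with hW
  have hIcc : Icc 1 T ⊆ Ioi 0 := fun s hs => one_pos.trans_le hs.1
  have hpos : ∀ {s : ℝ}, s ∈ Icc 1 T → 0 < s := fun hs => hIcc hs
  -- tails data on the window, with a rate not exceeding the Gaussian rate of `U_B'`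
  obtain ⟨C, k₀, hk₀, hCk⟩ := htails 1 T one_pos hT
  set κ : ℝ := burgersLayerRate 1 ν with hκ
  have hκ0 : 0 < κ := burgersLayerRate_pos one_pos hν
  set k : ℝ := min k₀ κ with hk
  have hk0 : 0 < k := lt_min hk₀ hκ0
  have hST : ∀ s ∈ Icc 1 T, SliceTails C k (u s) (v s) := fun s hs =>
    laminarMean_sliceTails_mono (hCk s hs).1 (min_le_left _ _)
  have hC : 0 ≤ C := (hST 1 (left_mem_Icc.2 hT.le)).nonneg
  -- the profile derivative: continuity, sign, Gaussian bound in exponential dress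
  have hUc : Continuous U' :=
    continuous_iff_continuousAt.2 fun s => (hasDerivAt_burgersLayerProfileD 1 ν 1 s).continuousAt
  set A : ℝ := 1 / Real.sqrt Real.pi * κ * Real.exp (1 / 4) with hA
  have hA0 : 0 ≤ A := by positivity
  have hU0 : ∀ y, 0 ≤ U' y := fun y => burgersLayerProfileD_nonneg 1 ν zero_le_one y
  have hUexp : ∀ y, U' y ≤ A * Real.exp (-k * |y|) := by
    intro y
    have h1 : U' y ≤ A * Real.exp (-κ * |y|) := burgersLayerProfileD_le_exp (γ := 1) (ν := ν) zero_le_one y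
    have h2 : Real.exp (-κ * |y|) ≤ Real.exp (-k * |y|) :=
      Real.exp_le_exp.2 (by nlinarith [abs_nonneg y, min_le_right k₀ κ])
    exact h1.trans (mul_le_mul_of_nonneg_left h2 hA0)
  have hUA : ∀ y, U' y ≤ A := fun y =>
    (hUexp y).trans (mul_le_of_le_one_right hA0 (exp_neg_mul_abs_le_one hk0 y))
  have hUsq : ∀ y, U' y ^ 2 ≤ A ^ 2 * Real.exp (-k * |y|) := by
    intro y
    calc U' y ^ 2 = U' y * U' y := sq _
      _ ≤ A * (A * Real.exp (-k * |y|)) := mul_le_mul (hUA y) (hUexp y) (hU0 y) hA0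
      _ = A ^ 2 * Real.exp (-k * |y|) := by ring
  -- slice regularity
  have cu : ∀ {s : ℝ}, 0 < s → ContDiff ℝ 1 (fun q : ℝ × ℝ => u s q.1 q.2) := fun hs =>
    (hsol.contDiff_u (mem_Ioi.2 hs)).of_le one_le_two
  have cv : ∀ {s : ℝ}, 0 < s → ContDiff ℝ 1 (fun q : ℝ × ℝ => v s q.1 q.2) := fun hs =>
    (hsol.contDiff_v (mem_Ioi.2 hs)).of_le one_le_two
  have cW : ∀ {s : ℝ}, 0 < s → Continuous (fun q : ℝ × ℝ => dX (u s) q.1 q.2 ^ 2 +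
      (dY (u s) q.1 q.2 - U' q.2) ^ 2 + dX (v s) q.1 q.2 ^ 2 + dY (v s) q.1 q.2 ^ 2) := fun hs =>
    ((((continuous_dX (cu hs)).pow 2).add (((continuous_dY (cu hs)).sub (hUc.comp continuous_snd)).pow 2)).add
      ((continuous_dX (cv hs)).pow 2)).add ((continuous_dY (cv hs)).pow 2)
  have cX : ∀ {s : ℝ}, 0 < s → Continuous (fun q : ℝ × ℝ => dX (u s) q.1 q.2 ^ 2 + dY (u s) q.1 q.2 ^ 2 +
      dX (v s) q.1 q.2 ^ 2 + dY (v s) q.1 q.2 ^ 2) := fun hs =>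
    ((((continuous_dX (cu hs)).pow 2).add ((continuous_dY (cu hs)).pow 2)).add
      ((continuous_dX (cv hs)).pow 2)).add ((continuous_dY (cv hs)).pow 2)
  -- pointwise bounds on the window
  have bX : ∀ s ∈ Icc 1 T, ∀ x y, |dX (u s) x y ^ 2 + dY (u s) x y ^ 2 + dX (v s) x y ^ 2 + dY (v s) x y ^ 2| ≤
      C ^ 2 * Real.exp (-k * |y|) := fun s hs x y => (hST s hs).abs_gradSq_le hk0 x y
  have bW : ∀ s ∈ Icc 1 T, ∀ x y, |dX (u s) x y ^ 2 + (dY (u s) x y - U' y) ^ 2 + dX (v s) x y ^ 2 +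
      dY (v s) x y ^ 2| ≤ (2 * C ^ 2 + 2 * A ^ 2) * Real.exp (-k * |y|) := by
    intro s hs x y
    have h1 := (le_abs_self _).trans (bX s hs x y)
    have h2 := hUsq y
    rw [abs_of_nonneg (by positivity)]
    nlinarith [sq_nonneg (dY (u s) x y + U' y), sq_nonneg (dX (u s) x y), sq_nonneg (dX (v s) x y),
      sq_nonneg (dY (v s) x y)]
  -- strip integrability on the window
  have iX : ∀ s ∈ Icc 1 T, IntegrableOn (fun q : ℝ × ℝ => dX (u s) q.1 q.2 ^ 2 + dY (u s) q.1 q.2 ^ 2 +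
      dX (v s) q.1 q.2 ^ 2 + dY (v s) q.1 q.2 ^ 2) (Ioc 0 L ×ˢ univ) := fun s hs =>
    integrableOn_strip_of_abs_le_exp (C := C ^ 2) (cX (hpos hs)) (by positivity) hk0 fun x _ y => bX s hs x y
  have iW : ∀ s ∈ Icc 1 T, IntegrableOn (fun q : ℝ × ℝ => dX (u s) q.1 q.2 ^ 2 + (dY (u s) q.1 q.2 - U' q.2) ^ 2 +
      dX (v s) q.1 q.2 ^ 2 + dY (v s) q.1 q.2 ^ 2) (Ioc 0 L ×ˢ univ) := fun s hs =>
    integrableOn_strip_of_abs_le_exp (C := 2 * C ^ 2 + 2 * A ^ 2) (cW (hpos hs)) (by positivity) hk0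
      fun x _ y => bW s hs x y
  have iU : IntegrableOn (fun q : ℝ × ℝ => U' q.2 ^ 2) (Ioc 0 L ×ˢ univ) :=
    integrableOn_strip_of_abs_le_exp (C := A ^ 2) ((hUc.comp continuous_snd).pow 2) (by positivity) hk0
      fun x _ y => by rw [abs_of_nonneg (sq_nonneg _)]; exact hUsq y
  -- the laminar constant: `ν ∫∫ U_B'² = c L`
  set B : ℝ := ∫ q in Ioc 0 L ×ˢ univ, U' q.2 ^ 2 with hB
  have hνB : ν * B = c * L := by
    have h1 : B = ∫ x in Ioc 0 L, ∫ y, U' y ^ 2 := (integral_iterated_eq_strip iU).symm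
    have h2 := nu_mul_integral_burgersLayerProfileD_sq one_pos hν 1
    simp only [one_pow, one_mul] at h2
    rw [h1, setIntegral_const, measureReal_def, Real.volume_Ioc, sub_zero, ENNReal.toReal_ofReal hL.le,
      smul_eq_mul]
    calc ν * (L * ∫ y, U' y ^ 2) = (ν * ∫ y, U' y ^ 2) * L := by ring
      _ = c * L := by rw [h2]
  -- the iterated `‖∇w‖²` is the strip one on the window
  have hWeq : ∀ s ∈ Icc 1 T, (∫ x in Ioc 0 L, ∫ y, (dX (u s) x y ^ 2 + (dY (u s) x y - U' y) ^ 2 +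
      dX (v s) x y ^ 2 + dY (v s) x y ^ 2)) = W s := fun s hs => integral_iterated_eq_strip (iW s hs)
  -- the iterated enstrophy is the strip `∫∫ |∇(u,v)|²` on the window
  have hΩX : ∀ s ∈ Icc 1 T, Ω s = X s := by
    intro s hs
    have hs' : s ∈ Ioi (0:ℝ) := hpos hs
    rw [hΩ]
    dsimp only
    rw [(faces_slice hν hL hsol htails (hpos hs)).1,
      ← kato_integral_gradSq_eq_enstrophy hL hk0 (hST s hs) (hsol.contDiff_u hs') (hsol.contDiff_v hs')
        (hsol.divFree s hs') (hsol.periodic_u s hs') (hsol.periodic_v s hs')]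
  -- the slice estimate: `|ν X − c L| ≤ δ c L + (1 + 1/δ) ν W`
  have hslice : ∀ s ∈ Icc 1 T, |ν * X s - c * L| ≤ δ * (c * L) + (1 + 1 / δ) * (ν * W s) := by
    intro s hs
    have hsub : X s - B = ∫ q in Ioc 0 L ×ˢ univ, (dX (u s) q.1 q.2 ^ 2 + dY (u s) q.1 q.2 ^ 2 +
        dX (v s) q.1 q.2 ^ 2 + dY (v s) q.1 q.2 ^ 2 - U' q.2 ^ 2) := (integral_sub (iX s hs) iU).symm
    have hbd : ‖∫ q in Ioc 0 L ×ˢ univ, (dX (u s) q.1 q.2 ^ 2 + dY (u s) q.1 q.2 ^ 2 +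
        dX (v s) q.1 q.2 ^ 2 + dY (v s) q.1 q.2 ^ 2 - U' q.2 ^ 2)‖ ≤
        ∫ q in Ioc 0 L ×ˢ univ, (δ * U' q.2 ^ 2 + (1 + 1 / δ) * (dX (u s) q.1 q.2 ^ 2 +
          (dY (u s) q.1 q.2 - U' q.2) ^ 2 + dX (v s) q.1 q.2 ^ 2 + dY (v s) q.1 q.2 ^ 2)) :=
      norm_integral_le_of_norm_le ((iU.const_mul δ).add ((iW s hs).const_mul _))
        (Eventually.of_forall fun q => by
          rw [Real.norm_eq_abs]
          exact laminarMean_pointwise _ _ _ _ _ hδ)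
    rw [integral_add (iU.const_mul δ) ((iW s hs).const_mul _), integral_const_mul, integral_const_mul] at hbd
    have hbd' : |X s - B| ≤ δ * B + (1 + 1 / δ) * W s := by rw [hsub, ← Real.norm_eq_abs]; exact hbd
    have hid : ν * X s - c * L = ν * (X s - B) := by rw [← hνB]; ring
    rw [hid, abs_mul, abs_of_pos hν]
    calc ν * |X s - B| ≤ ν * (δ * B + (1 + 1 / δ) * W s) := mul_le_mul_of_nonneg_left hbd' hν.le
      _ = δ * (ν * B) + (1 + 1 / δ) * (ν * W s) := by ring
      _ = δ * (c * L) + (1 + 1 / δ) * (ν * W s) := by rw [hνB]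
  -- time continuity of `W` on the window (dominated convergence on the strip)
  have hWc : ContinuousOn W (Icc 1 T) := by
    refine continuousOn_of_dominated (bound := fun q : ℝ × ℝ => (2 * C ^ 2 + 2 * A ^ 2) * Real.exp (-k * |q.2|))
      (fun σ hσ => (cW (hpos hσ)).aestronglyMeasurable) (fun σ hσ => Eventually.of_forall fun q => ?_)
      ((kato_integrableOn_weight hk0 L).const_mul _) (Eventually.of_forall fun q => ?_)
    · rw [Real.norm_eq_abs]
      exact bW σ hσ q.1 q.2
    · have hu := hsol.contDiffOn_u
      have hv := hsol.contDiffOn_v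
      exact (((((continuousOn_time_dX hu q.1 q.2).mono hIcc).pow 2).add
        ((((continuousOn_time_dY hu q.1 q.2).mono hIcc).sub continuousOn_const).pow 2)).add
        (((continuousOn_time_dX hv q.1 q.2).mono hIcc).pow 2)).add
        (((continuousOn_time_dY hv q.1 q.2).mono hIcc).pow 2)
  have hWi : IntervalIntegrable W volume 1 T := hWc.intervalIntegrable_of_Icc hT.le
  -- time integrability of the enstrophy
  have hsub : uIcc 1 T ⊆ Ioi 0 := fun τ hτ => by rw [uIcc_of_le hT.le] at hτ; exact hpos hτ
  have hΩi : IntervalIntegrable Ω volume 1 T :=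
    ((faces_enstrophy_continuousOn hν hL hsol htails).mono hsub).intervalIntegrable
  -- the window as a real time integral
  have hface : L * (∫⁻ t in Ioc 1 T, layerDissipation ν L (u t) (v t)).toReal = ν * ∫ τ in (1:ℝ)..T, Ω τ :=
    faces_enstrophy hν hL hsol htails hT
  have hLHS : ∫ τ in (1:ℝ)..T, (ν * Ω τ - c * L) = ν * (∫ τ in (1:ℝ)..T, Ω τ) - (T - 1) * (c * L) := by
    rw [intervalIntegral.integral_sub (hΩi.const_mul ν) intervalIntegrable_const,
      intervalIntegral.integral_const_mul, intervalIntegral.integral_const, smul_eq_mul]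
  have hRHS : ∫ τ in (1:ℝ)..T, (δ * (c * L) + (1 + 1 / δ) * (ν * W τ)) =
      (T - 1) * (δ * (c * L)) + (1 + 1 / δ) * (ν * ∫ τ in (1:ℝ)..T, W τ) := by
    rw [intervalIntegral.integral_add intervalIntegrable_const ((hWi.const_mul ν).const_mul _),
      intervalIntegral.integral_const, smul_eq_mul, intervalIntegral.integral_const_mul,
      intervalIntegral.integral_const_mul]
  have hkey : ‖∫ τ in (1:ℝ)..T, (ν * Ω τ - c * L)‖ ≤ ∫ τ in (1:ℝ)..T, (δ * (c * L) + (1 + 1 / δ) * (ν * W τ)) :=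
    intervalIntegral.norm_integral_le_of_norm_le hT.le
      (Eventually.of_forall fun τ hτ => by
        rw [Real.norm_eq_abs, hΩX τ (Ioc_subset_Icc_self hτ)]
        exact hslice τ (Ioc_subset_Icc_self hτ))
      (intervalIntegrable_const.add ((hWi.const_mul ν).const_mul _))
  rw [Real.norm_eq_abs, hLHS, hRHS] at hkey
  have hWint : ∫ τ in (1:ℝ)..T, W τ = ∫ τ in (1:ℝ)..T, ∫ x in Ioc 0 L, ∫ y,
      (dX (u τ) x y ^ 2 + (dY (u τ) x y - U' y) ^ 2 + dX (v τ) x y ^ 2 + dY (v τ) x y ^ 2) :=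
    intervalIntegral.integral_congr fun τ hτ => (hWeq τ (by rwa [uIcc_of_le hT.le] at hτ)).symm
  have e1 : L * (∫⁻ t in Ioc 1 T, layerDissipation ν L (u t) (v t)).toReal - c * L * (T - 1) =
      ν * (∫ τ in (1:ℝ)..T, Ω τ) - (T - 1) * (c * L) := by rw [hface]; ring
  rw [e1, ← hWint]
  calc _ ≤ _ := hkey
    _ = _ := by ring

end LaminarMean

/-- **Energy relaminarisation forces the laminar mean dissipation (registered sub-goal
`meanLayerDissipation_laminar_of_energyDecay` of line `FirstLemmasR2K4`).** For one classical solution of the stretched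
layer class on `(0, ∞)` (`ν > 0`, period `L > 0`) with shear tails on every compact time window and locally finite
dissipation: if its perturbation energy about the Burgers layer relaxes, `W(t) ≤ e^{−(t−s)/2} W(s)`, with the gradient
budget `ν ∫_s^t ‖∇w‖² ≤ (3/2 + 1/(πν)) W(s)` (`0 < s ≤ t`), then
`meanLayerDissipation ν L u v = ofReal (√ν/(2√π))` — the laminar Sweet–Parker value, so such a member can never
witness an `L`-proportional dissipation floor at small `ν`. (`laminarMean_window` + the budget at `s = 1` give
`|mean(T) − √ν/(2√π)| ≤ K(δ)/T + δ √ν/(2√π)` for all `δ > 0`, `T > 1`; the `liminf` of the convergent Cesàro means is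
their limit.) [folklore] -/
theorem meanLayerDissipation_laminar_of_energyDecay : ∀ (ν L : ℝ), 0 < ν → 0 < L → ∀ (u v p : ℝ → ℝ → ℝ → ℝ), IsStretchedLayerNSSolutionOn (Ioi 0) ν 1 1 L u v p → (∀ a b : ℝ, 0 < a → a < b → ExpTails (Icc a b) u v) → (∀ T : ℝ, 0 < T → ∫⁻ t in Ioc 0 T, layerDissipation ν L (u t) (v t) ≠ ∞) → (∀ s t : ℝ, 0 < s → s ≤ t → (∫ x in Ioc 0 L, ∫ y, ((u t x y - burgersLayerProfile 1 ν 1 y) ^ 2 + v t x y ^ 2)) ≤ Real.exp (-(t - s) / 2) * (∫ x in Ioc 0 L, ∫ y, ((u s x y - burgersLayerProfile 1 ν 1 y) ^ 2 + v s x y ^ 2)) ∧ ν * (∫ τ in s..t, ∫ x in Ioc 0 L, ∫ y, (dX (u τ) x y ^ 2 + (dY (u τ) x y - burgersLayerProfileD 1 ν 1 y) ^ 2 + dX (v τ) x y ^ 2 + dY (v τ) x y ^ 2)) ≤ (3 / 2 + 1 / (Real.pi * ν)) * ∫ x in Ioc 0 L, ∫ y, ((u s x y - burgersLayerProfile 1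 ν 1 y) ^ 2 + v s x y ^ 2)) → meanLayerDissipation ν L u v = ENNReal.ofReal (Real.sqrt ν / (2 * Real.sqrt Real.pi)) := by
  intro ν L hν hL u v p hsol htails hfin hdecay
  set c : ℝ := Real.sqrt ν / (2 * Real.sqrt Real.pi) with hc
  have hc0 : 0 < c := div_pos (Real.sqrt_pos.2 hν) (mul_pos two_pos (Real.sqrt_pos.2 Real.pi_pos))
  -- the gradient budget from time `1`
  set G : ℝ := (3 / 2 + 1 / (Real.pi * ν)) *
    ∫ x in Ioc 0 L, ∫ y, ((u 1 x y - burgersLayerProfile 1 ν 1 y) ^ 2 + v 1 x y ^ 2) with hG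
  have hbudget : ∀ T : ℝ, 1 ≤ T → ν * (∫ τ in (1:ℝ)..T, ∫ x in Ioc 0 L, ∫ y,
      (dX (u τ) x y ^ 2 + (dY (u τ) x y - burgersLayerProfileD 1 ν 1 y) ^ 2 + dX (v τ) x y ^ 2 +
        dY (v τ) x y ^ 2)) ≤ G := fun T hT => (hdecay 1 T one_pos hT).2
  -- the finite head `(0, 1]` and the finite windows `(1, T]` as real numbers
  obtain ⟨h₀, hh₀, hhead⟩ : ∃ r : ℝ, 0 ≤ r ∧ ∫⁻ t in Ioc 0 1, layerDissipation ν L (u t) (v t) = ENNReal.ofReal r :=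
    ⟨_, ENNReal.toReal_nonneg, (ENNReal.ofReal_toReal (hfin 1 one_pos)).symm⟩
  have hsplit : ∀ T : ℝ, 1 ≤ T → ∫⁻ t in Ioc 0 T, layerDissipation ν L (u t) (v t) =
      (∫⁻ t in Ioc 0 1, layerDissipation ν L (u t) (v t)) + ∫⁻ t in Ioc 1 T, layerDissipation ν L (u t) (v t) :=
    fun T hT => enstrophyMeanFloor_lintegral_split (fun t => layerDissipation ν L (u t) (v t)) hT
  have htail : ∀ T : ℝ, 1 ≤ T → ∫⁻ t in Ioc 1 T, layerDissipation ν L (u t) (v t) ≠ ∞ := by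
    intro T hT
    have h := hfin T (one_pos.trans_le hT)
    rw [hsplit T hT] at h
    exact (ENNReal.add_ne_top.1 h).2
  set J : ℝ → ℝ := fun T => (∫⁻ t in Ioc 1 T, layerDissipation ν L (u t) (v t)).toReal with hJ
  have hJ0 : ∀ T, 0 ≤ J T := fun T => ENNReal.toReal_nonneg
  have hJeq : ∀ T : ℝ, 1 ≤ T → ∫⁻ t in Ioc 1 T, layerDissipation ν L (u t) (v t) = ENNReal.ofReal (J T) :=
    fun T hT => (ENNReal.ofReal_toReal (htail T hT)).symm
  -- the Cesàro means as `ofReal` of real numbers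
  set m : ℝ → ℝ := fun T => T⁻¹ * (h₀ + J T) with hm
  have hmean : ∀ T : ℝ, 1 ≤ T →
      ENNReal.ofReal T⁻¹ * ∫⁻ t in Ioc 0 T, layerDissipation ν L (u t) (v t) = ENNReal.ofReal (m T) := by
    intro T hT
    rw [hsplit T hT, hhead, hJeq T hT, ← ENNReal.ofReal_add hh₀ (hJ0 T),
      ← ENNReal.ofReal_mul (inv_nonneg.2 (zero_le_one.trans hT))]
  -- the real estimate: `|m T − c| ≤ K(δ)/T + δ c`
  have hreal : ∀ δ : ℝ, 0 < δ → ∀ T : ℝ, 1 < T →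
      |m T - c| ≤ (h₀ + c + (1 + 1 / δ) * G / L) / T + δ * c := by
    intro δ hδ T hT
    have hT0 : 0 < T := one_pos.trans hT
    have hw := laminarMean_window hν hL hsol htails hT hδ
    have hb := hbudget T hT.le
    have hδ1 : 0 ≤ 1 + 1 / δ := by positivity
    have hE : L * |J T - c * (T - 1)| ≤ δ * (c * L) * (T - 1) + (1 + 1 / δ) * G := by
      have h1 : L * |J T - c * (T - 1)| = |L * J T - c * L * (T - 1)| := by
        rw [← abs_of_pos hL, ← abs_mul, abs_of_pos hL]; ring_nf
      rw [h1]
      exact hw.trans (add_le_add le_rfl (mul_le_mul_of_nonneg_left hb hδ1))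
    have hE' : |J T - c * (T - 1)| ≤ δ * c * (T - 1) + (1 + 1 / δ) * G / L := by
      refine le_of_mul_le_mul_left ?_ hL
      have : L * (δ * c * (T - 1) + (1 + 1 / δ) * G / L) = δ * (c * L) * (T - 1) + (1 + 1 / δ) * G := by
        field_simp
      rw [this]
      exact hE
    have hmT : m T - c = (h₀ - c + (J T - c * (T - 1))) / T := by
      rw [hm]
      field_simp
      ring
    rw [hmT, abs_div, abs_of_pos hT0, div_le_iff₀ hT0]
    have habs : |h₀ - c + (J T - c * (T - 1))| ≤ (h₀ + c) + (δ * c * (T - 1) + (1 + 1 / δ) * G / L) := by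
      calc |h₀ - c + (J T - c * (T - 1))| ≤ |h₀ - c| + |J T - c * (T - 1)| := abs_add_le _ _
        _ ≤ (h₀ + c) + (δ * c * (T - 1) + (1 + 1 / δ) * G / L) := by
            refine add_le_add ((abs_sub _ _).trans ?_) hE'
            rw [abs_of_nonneg hh₀, abs_of_pos hc0]
    refine habs.trans ?_
    have hexp : ((h₀ + c + (1 + 1 / δ) * G / L) / T + δ * c) * T = h₀ + c + (1 + 1 / δ) * G / L + δ * c * T := by
      field_simp
    rw [hexp]
    nlinarith [mul_pos hδ hc0]
  -- the real Cesàro means converge to `c`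
  have hlim : Tendsto m atTop (𝓝 c) := by
    rw [Metric.tendsto_nhds]
    intro ε hε
    set δ : ℝ := ε / (2 * (c + 1)) with hδ
    have hδ0 : 0 < δ := by positivity
    have hδc : δ * c < ε := by
      rw [hδ, div_mul_eq_mul_div, div_lt_iff₀ (by positivity)]
      nlinarith
    set K : ℝ := h₀ + c + (1 + 1 / δ) * G / L with hK
    have hKt : Tendsto (fun T : ℝ => K / T + δ * c) atTop (𝓝 (0 + δ * c)) :=
      (tendsto_const_nhds.div_atTop tendsto_id).add tendsto_const_nhds
    rw [zero_add] at hKt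
    filter_upwards [hKt.eventually_lt_const hδc, eventually_gt_atTop 1] with T h1 h2
    rw [Real.dist_eq]
    exact (hreal δ hδ0 T h2).trans_lt h1
  -- hence the `ℝ≥0∞` means converge, and the liminf is the limit
  have hlimE : Tendsto (fun T : ℝ => ENNReal.ofReal T⁻¹ * ∫⁻ t in Ioc 0 T, layerDissipation ν L (u t) (v t)) atTop
      (𝓝 (ENNReal.ofReal c)) := by
    refine (ENNReal.tendsto_ofReal hlim).congr' ?_
    filter_upwards [eventually_ge_atTop 1] with T hT
    exact (hmean T hT).symm
  rw [meanLayerDissipation_def]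
  exact hlimE.liminf_eq

end Summit.AnomalousDissipation.AnomalousDissipation.Theorems.StrainedLayerLaw.LogEnstrophyClock

end
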